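import Mathlib
import Summits.NavierStokesRegularity.NavierStokesRegularity.Theses.L3TimeExponentPincer
import Summits.NavierStokesRegularity.NavierStokesRegularity.Theorems.NoBlowupToClay
import HarnessLib.Audit
import HarnessLib

/-!
# Route `L3TimeExponentPincer` — `NoBlowupToClay` (item stmt-NavierStokesRegularity-19501)

The shared frame support item of the positive Navier–Stokes routes, here for route `L3TimeExponentPincer`:
`NoBlowup → NavierStokesRegularity`, where `NoBlowup` says that every classical solution of the unforced
Navier–Stokes system on `ℝ³ × [0, T)` which is Leray–Hopf on `[0, T]` from a rapidly decaying datum extends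
smoothly past `T`, and `NavierStokesRegularity` is Fefferman's Clay statement (A).  The item is byte-identical to
the shared item stmt-NavierStokesRegularity-0055, proved route-independently in the tree by
`Summit.NavierStokesRegularity.NavierStokesRegularity.Theorems.navierStokesRegularity_of_noBlowup`
(`Theorems/NoBlowupToClay.lean`); this file instantiates that theorem at the route's copy of the decl, exactly as
`Theorems/ContinuousAlignmentNoBlowupToClay.lean` does for route `ContinuousAlignment`.

## References
* J. Leray, Acta Math. 63 (1934), §III and Ch. V §31.
* C. L. Fefferman, *Existence and smoothness of the Navier–Stokes equation*, Clay (2000/2006), (A).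
* P. G. Lemarié-Rieusset, *The Navier–Stokes Problem in the 21st Century*, CRC 2016, Prop. 12.3, Thm. 15.1 (C).
-/

namespace Summit.NavierStokesRegularity.NavierStokesRegularity.Theorems.L3TimeExponentPincerNoBlowupToClay

/-- **Item `L3TimeExponentPincer.NoBlowupToClay` (stmt-NavierStokesRegularity-19501) holds**: the route decl
unfolds to the type of the route-independent tree theorem `navierStokesRegularity_of_noBlowup`. -/
theorem noBlowupToClay_item :
    Summit.NavierStokesRegularity.NavierStokesRegularity.Theses.L3TimeExponentPincer.NoBlowupToClay := by
  unfold Summit.NavierStokesRegularity.NavierStokesRegularity.Theses.L3TimeExponentPincer.NoBlowupToClay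
  exact Summit.NavierStokesRegularity.NavierStokesRegularity.Theorems.navierStokesRegularity_of_noBlowup


end Summit.NavierStokesRegularity.NavierStokesRegularity.Theorems.L3TimeExponentPincerNoBlowupToClay
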